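import Summits.BirchSwinnertonDyer.BirchSwinnertonDyer.Theorems.KimAtThreeDeepUpperExpStarFacts
import Summits.BirchSwinnertonDyer.BirchSwinnertonDyer.Theorems.KimAtThreeDeepLowerExpStarOmegaLine
import Literature.NumberTheory.GaloisRepresentations.LocalFieldPadicProofs
import Literature.NumberTheory.GaloisRepresentations.PadicAlgebraIntegral
import HarnessLib

/-!
# The `exp*`-side clauses for EVERY identification `ℚ_v → ℚ_p` and for an EXACT Néron line
# (route `KimAtThreeKolyvagin`, rung W2, cruxes 19075 / 19076 / 19560; cell `bsd-addord`, seat w2-c3 gen 8)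

HONEST FRAMING. Theorems only (local instances as in `KimAtThreeDeepLowerExpStarOmegaPlace`); nothing is
closed or booked; BSD is not proved by any of this. Sequel to `KimAtThreeDeepUpperExpStarFacts`:

* `ringHom_place_padic_ext` — **rigidity: any two ring homomorphisms `ℚ_v → ℚ_p` coincide** (`v ∋ p`;
  the canonical `algebraMap ℚ_p ℚ_v` is onto — it is the inverse of Mathlib's `padicEquiv`,
  `algebraMap_eq_symm` — and a ring endomorphism of `ℚ_p` is the identity, `LocalField.ringHom_padic_ext`
  with `Padic.isNonarchimedeanLocalField_holds`). So the consumers' `ι` (w2-c2's `∃ ιp`, kim3's fixed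
  `(Padic.adicCompletionEquiv (𝓞 ℚ) ⟨3, _⟩).symm`) are all the same map.
* `hdual_of_facts_of_ringHom` — `hdual` from (S5b) for EVERY `ι : ℚ_v →+* ℚ_p` (not only the one the
  existential of `hdual_of_facts` produces).
* `exists_neronLine_of_facts` — from the four cite facts and `PAdicHodge.nonempty_neronDeRhamDatum`:
  **there is a local Néron line `d` (an EXACT one: the rescaled generator) with `hinj`, `hex`, `hker` and
  `hdual` for `expStarOmegaPadicAt d hinj hex ι`**, for every `ι` — the shape of the first block
  `∃ d hinj hex, hdual ∧ …` of kim3's displayed Kato-v2 text (HKATO2) and of its hS5a (HS5A), at any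
  place `v ∋ p` (kim3: `v := primesEquiv.symm ⟨3, _⟩`).

References: [Kato1993LNM1553] Ch. II Prop. 1.2.3, §1.2.4, Thm. 1.4.1; [BlochKato1990] §3 (Prop. 3.8,
Ex. 3.11); [SerreLocalFields1979] Ch. II §5 (rigidity of `ℚ_p`).
-/

set_option autoImplicit false
-- the Theorems namespace of a single-conjunct summit repeats the summit name by design (D-0017)
set_option linter.dupNamespace false

noncomputable section

open scoped NumberField NNReal
open Field ValuativeRel IsDedekindDomain NumberField
open Literature.NumberTheory.GaloisRepresentations
open Literature.NumberTheory.GaloisRepresentations.PeriodRingData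
open Literature.NumberTheory.PAdicHodge
open Literature.NumberTheory.EllipticCurves WeierstrassCurve
open Summit.BirchSwinnertonDyer.BirchSwinnertonDyer.Theorems.KimAtThreeDeepLowerExpStarOmega
open Summit.BirchSwinnertonDyer.BirchSwinnertonDyer.Theorems.KimAtThreeDeepLowerExpStarOmegaPlace
open Summit.BirchSwinnertonDyer.BirchSwinnertonDyer.Theorems.KimAtThreeDeepLowerExpStarOmegaLine
open Summit.BirchSwinnertonDyer.BirchSwinnertonDyer.Theorems.KimAtThreeDeepUpperExpStarTransport
open Summit.BirchSwinnertonDyer.BirchSwinnertonDyer.Theorems.KimAtThreeDeepUpperExpStarFacts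
open Summit.BirchSwinnertonDyer.Rank1Residual.GaloisImage
open Summit.BirchSwinnertonDyer.Rank1Residual.Additive (LocalLog.padicLog)
open Rat.HeightOneSpectrum

namespace Summit.BirchSwinnertonDyer.BirchSwinnertonDyer.Theorems.KimAtThreeDeepUpperExpStarFactsCanonical

variable (W : WeierstrassCurve ℚ) [W.IsElliptic] (p : ℕ) [Fact p.Prime]
  (v : HeightOneSpectrum (𝓞 ℚ)) [hv : Fact (((p : ℕ) : 𝓞 ℚ) ∈ v.asIdeal)]

-- the tree's `ℚ`-algebra structure on `ℚ_v` first (see `KimAtThreeDeepUpperExpStarFacts`)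
attribute [local instance 100000] NumberField.Place.instAlgebraCompletion
attribute [local instance] valuativeRelPlace topologicalSpacePlace
attribute [local instance] isNonarchimedeanLocalField_place charZero_place
attribute [local instance] padicAlgebraPlace fact_not_isUnit_place isAdicComplete_place

omit [Fact p.Prime] hv in
/-- **Rigidity: any two ring homomorphisms `ℚ_v → ℚ_p` coincide** (`v ∋ p`). The canonical
`algebraMap ℚ_p ℚ_v` (`LocalField.adicCompletionPadicAlgebra`) is the inverse of Mathlib's `padicEquiv`,
hence onto; composing with it reduces the claim to ring endomorphisms of `ℚ_p`, which are all the identity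
(`LocalField.ringHom_padic_ext`). [cite: SerreLocalFields1979, Ch. II §5] -/
theorem ringHom_place_padic_ext [Fact p.Prime] [hv : Fact (((p : ℕ) : 𝓞 ℚ) ∈ v.asIdeal)]
    (ι ι' : Place.Completion (Sum.inr v : Place ℚ) →+* ℚ_[p]) : ι = ι' := by
  have hpv : ((p : ℕ) : 𝓞 ℚ) ∈ v.asIdeal := hv.out
  have hp' := primesEquiv_eq p v hpv
  subst hp'
  let eA0 : v.adicCompletion ℚ ≃ₐ[ℚ] ℚ_[((primesEquiv v : Nat.Primes) : ℕ)] :=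
    (adicCompletion.padicEquiv (R := 𝓞 ℚ) v).toAlgEquiv
  have hcont : Continuous eA0.symm := (adicCompletion.padicEquiv (R := 𝓞 ℚ) v).symm.continuous
  haveI : IsNonarchimedeanLocalField ℚ_[((primesEquiv v : Nat.Primes) : ℕ)] :=
    Padic.isNonarchimedeanLocalField_holds _
  -- the two composites `ℚ_p → ℚ_v → ℚ_p` coincide
  have hcomp : ι.comp (eA0.symm : ℚ_[((primesEquiv v : Nat.Primes) : ℕ)] →+* v.adicCompletion ℚ) =
      ι'.comp (eA0.symm : ℚ_[((primesEquiv v : Nat.Primes) : ℕ)] →+* v.adicCompletion ℚ) :=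
    LocalField.ringHom_padic_ext _ _
  refine RingHom.ext fun x => ?_
  have hx : x = eA0.symm (eA0 x) := (eA0.symm_apply_apply x).symm
  have h := RingHom.congr_fun hcomp (eA0 x)
  simp only [RingHom.coe_comp, Function.comp_apply] at h
  rw [hx]
  exact h

/-- **`hdual` from (S5b) for EVERY ring homomorphism `ι : ℚ_v → ℚ_p`** (rigidity applied to the
existential of `hdual_of_facts`). [cite: Kato1993LNM1553, Ch. II Thm. 1.4.1 (3)–(4)] [cite: BlochKato1990, Prop. 3.8 and Example 3.11] -/
theorem hdual_of_facts_of_ringHom [W.IsGloballyMinimal] (hT : exists_smul_range_expStarCoord_iff_trace_log)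
    (d : LocalNeronLineAt W p v)
    (hinj : (bdRPeriodRingData (valuation_place_lt_one p v)).CupLogInjective (logCyclotomic p)
      (localRationalTateRep W p (galRestrictPlace v)))
    (hex : ∀ z : contOneCocycles (localRationalTateRep W p (galRestrictPlace v)).toTopRep,
      (bdRPeriodRingData (valuation_place_lt_one p v)).HasDualExp (logCyclotomic p)
        (localRationalTateRep W p (galRestrictPlace v)) fun σ => z.1 σ)
    (ι : Place.Completion (Sum.inr v : Place ℚ) →+* ℚ_[p]) :
    ∃ (e : Place.Completion (Sum.inr v : Place ℚ)) (he : e ≠ 0),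
      ∀ a : ℚ_[p], (∃ y, expStarOmegaPadicAt (d.smul e he) hinj hex ι y = a) ↔
        ∀ Q : (W.baseChange ℚ_[p]).toAffine.Point, ‖a * LocalLog.padicLog (W.baseChange ℚ_[p]) Q‖ ≤ 1 := by
  obtain ⟨e, he, ι₀, h⟩ := hdual_of_facts W p v hT d hinj hex
  rw [ringHom_place_padic_ext p v ι ι₀]
  exact ⟨e, he, h⟩

/-- **An EXACT Néron line from the cite facts**: from the four Literature facts and the construction
statement `PAdicHodge.nonempty_neronDeRhamDatum` there is, at every place `v ∋ p` and for every
identification `ι : ℚ_v → ℚ_p`, a local Néron line `d` — the rescaling `e • d₀` of any line datum — with the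
Prop-1.2.3 binders `hinj`/`hex` such that `φ := expStarOmegaPadicAt d hinj hex ι` satisfies `hker` and
`hdual` VERBATIM. This is the first block `∃ d hinj hex, hdual ∧ …` of kim3's displayed Kato-v2 text and
its hS5a, now cite-only. [cite: Kato1993LNM1553, Ch. II Prop. 1.2.3, §1.2.4, Ex. 1.3.5 and Thm. 1.4.1] [cite: BlochKato1990, Lemma 3.8.1, Prop. 3.8 and Example 3.11] -/
theorem exists_neronLine_of_facts [W.IsGloballyMinimal] (hND : nonempty_neronDeRhamDatum)
    (hP : cupLogInjective_and_hasDualExp_of_isDeRham) (hDR : isDeRham_restrictedRationalTateRep)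
    (hS : expStarCoord_eq_zero_iff_kummer) (hT : exists_smul_range_expStarCoord_iff_trace_log)
    (ι : Place.Completion (Sum.inr v : Place ℚ) →+* ℚ_[p]) :
    ∃ (d : LocalNeronLineAt W p v)
      (hinj : (bdRPeriodRingData (valuation_place_lt_one p v)).CupLogInjective (logCyclotomic p)
        (localRationalTateRep W p (galRestrictPlace v)))
      (hex : ∀ z : contOneCocycles (localRationalTateRep W p (galRestrictPlace v)).toTopRep,
        (bdRPeriodRingData (valuation_place_lt_one p v)).HasDualExp (logCyclotomic p)
          (localRationalTateRep W p (galRestrictPlace v)) fun σ => z.1 σ),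
      (∀ y, expStarOmegaPadicAt d hinj hex ι y = 0 ↔
        ∀ j : ℕ, tateLocalMap W p j (Sum.inr v) y ∈
          W.kummerSelmerStructure (((p : ℕ) : ℤ) ^ j * ((p : ℕ) : ℤ)) (Sum.inr v)) ∧
      (∀ a : ℚ_[p], (∃ y, expStarOmegaPadicAt d hinj hex ι y = a) ↔
        ∀ Q : (W.baseChange ℚ_[p]).toAffine.Point, ‖a * LocalLog.padicLog (W.baseChange ℚ_[p]) Q‖ ≤ 1) := by
  obtain ⟨d₀⟩ := nonempty_localNeronLineAt_of_nonempty_neronDeRhamDatum W p v hND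
  obtain ⟨hinj, hex⟩ := hinj_hex_of_facts W p v hP hDR
  obtain ⟨e, he, hdual⟩ := hdual_of_facts_of_ringHom W p v hT d₀ hinj hex ι
  exact ⟨d₀.smul e he, hinj, hex, fun y => hker_of_facts W p v hS (d₀.smul e he) hinj hex ι y, hdual⟩

end Summit.BirchSwinnertonDyer.BirchSwinnertonDyer.Theorems.KimAtThreeDeepUpperExpStarFactsCanonical

end
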